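import Summits.BirchSwinnertonDyer.BirchSwinnertonDyer.Theorems.SignedLowerHalvesSmallImageLowerHalfBothSignsRttD2J1CyclotomicCarrier
import Literature.NumberTheory.GaloisRepresentations.RelativeCorestrictionNaturality
import HarnessLib

/-!
# Route `SignedLowerHalves`, crux L `SmallImageLowerHalfBothSigns` (stmt-BirchSwinnertonDyer-23599), line `rtt_w3` v14 → v15 — E2, row J3
# (Galois side, part β₀): CAST-FREE TRANSITION MAPS `n ≤ n′`, `k ≤ k′` FROM ONE-STEP MAPS (`Nat.leRec`), their functoriality and commutation,
# and the commutation `cor ∘ red = red ∘ cor` on honda's layer groups `H^i(G_P(K_n), 𝒪 ⊗ μ_{p^k} ⊗ θ)`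

WIDTH seat `bsd-line-slh-p3-w3` g22 under LEAD `cruxlead-stmt-BirchSwinnertonDyer-23599` g11 (cell `bsd-ssimc`); helper `--supports stmt-BirchSwinnertonDyer-23599`.
DEFINITIONS WITH BODIES (`downLE`, `upLE`) + THEOREMS; no named fact, no instance, no `sorry`. HONEST FRAMING: bookkeeping for the finite-level socket
`LayerPairing` of part α′ (its fields `coresLE`/`redLE`/`resLE`/`inclLE` ask for transition maps for ALL `n ≤ n′`, `k ≤ k′`, functorial, extending the one-step maps and
commuting); nothing arithmetic is proved; E2, crux L, crux M and BSD remain OPEN and are proved for NO curve.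

* §1 (generic, any `ℕ`-indexed family of abelian groups) `downLE t h : G m →+ G n` (`n ≤ m`) from one-step maps `t n : G (n+1) →+ G n` and `upLE s h : G n →+ G m` from
  `s n : G n →+ G (n+1)` — `Nat.leRec`, so NO casts along `n + (m − n) = m`; `_refl`, `_succ`, `_one`, `_trans`, and naturality `downLE_map` (a family of maps
  intertwining the one-step maps intertwines all transitions).
* §2 (generic double systems) `downLE_comm`: if the one-step maps in the two directions commute, so do all the transitions.
* §3 ★ `cycLayerCoresO_cycLayerRedO`: on honda's layer groups (p782087) the corestriction `cor_{K_{n+1}/K_n}` and the reduction `μ_{p^{k+1}} → μ_{p^k}` COMMUTE (the tree's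
  `relCor_cohomologyMap`: relative corestriction is natural in coefficient morphisms), hence (§2) all the transitions `cycCoresLE`/`cycRedLE` commute
  (`cycCoresLE_cycRedLE`) — the `coresLE`/`redLE` block of the socket `LayerPairing`, for every `K`, `p`, `S`, `κ`, `θ`, `P`, `i`.
References: [NeukirchSchmidtWingberg2008] I §5 Prop. 1.5.2–1.5.4; [Kato2004Asterisque] §8.2 (p. 180); [SerreGaloisCohomology1997] I §2.5.
-/

set_option autoImplicit false
set_option linter.dupNamespace false -- D-0017: single-problem summit, the namespace repeats the problem name by design
noncomputable section

open scoped NumberField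
open CategoryTheory Field IsDedekindDomain
open Literature.NumberTheory.GaloisRepresentations
open Literature.NumberTheory.EllipticCurves
open Literature.NumberTheory.ComplexMultiplication.EllipticUnits.JohnsonLeungKings2011

namespace Summit.BirchSwinnertonDyer.BirchSwinnertonDyer.Theorems.SmallImageRttD2Seq

/-! ## §1. Transitions along `≤` from one-step maps -/

section Generic

universe w

variable {G : ℕ → Type w} [∀ n, AddCommGroup (G n)]

/-- **The descending transition `G m → G n` (`n ≤ m`)** obtained by composing the one-step maps `t j : G (j+1) → G j` (`Nat.leRec` on the proof of `n ≤ m`: no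
transport along `n + (m - n) = m`). [cite: NeukirchSchmidtWingberg2008, I §5 Prop. 1.5.2] -/
def downLE (t : ∀ j : ℕ, G (j + 1) →+ G j) {n m : ℕ} (h : n ≤ m) : G m →+ G n :=
  Nat.leRec (motive := fun m _ ↦ G m →+ G n) (AddMonoidHom.id (G n)) (fun m _ f ↦ f.comp (t m)) h

/-- `downLE` along `n ≤ n` is the identity. [folklore] -/
theorem downLE_refl (t : ∀ j : ℕ, G (j + 1) →+ G j) (n : ℕ) (y : G n) : downLE t (le_refl n) y = y := by
  rw [downLE, Nat.leRec_self]; rfl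

/-- `downLE` along `n ≤ m + 1` factors through the last step. [folklore] -/
theorem downLE_succ (t : ∀ j : ℕ, G (j + 1) →+ G j) {n m : ℕ} (h : n ≤ m) (h' : n ≤ m + 1) (y : G (m + 1)) :
    downLE t h' y = downLE t h (t m y) := by
  rw [downLE, Nat.leRec_succ _ _ h]; rfl

/-- `downLE` along `n ≤ n + 1` is the one-step map. [folklore] -/
theorem downLE_one (t : ∀ j : ℕ, G (j + 1) →+ G j) (n : ℕ) (y : G (n + 1)) : downLE t (Nat.le_succ n) y = t n y := by
  rw [downLE_succ t (le_refl n), downLE_refl]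

/-- `downLE` is transitive. [folklore] -/
theorem downLE_trans (t : ∀ j : ℕ, G (j + 1) →+ G j) {n m l : ℕ} (h : n ≤ m) (h' : m ≤ l) (y : G l) :
    downLE t h (downLE t h' y) = downLE t (h.trans h') y := by
  induction l, h' using Nat.le_induction with
  | base => rw [downLE_refl]
  | succ l h' ih => rw [downLE_succ t h', ih, ← downLE_succ t (h.trans h')]

/-- **Naturality**: maps `φ j : G j → G′ j` intertwining the one-step maps intertwine all the transitions. [folklore] -/
theorem downLE_map {G' : ℕ → Type w} [∀ n, AddCommGroup (G' n)] (t : ∀ j : ℕ, G (j + 1) →+ G j) (t' : ∀ j : ℕ, G' (j + 1) →+ G' j)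
    (φ : ∀ j : ℕ, G j →+ G' j) (hφ : ∀ (j : ℕ) (y : G (j + 1)), φ j (t j y) = t' j (φ (j + 1) y)) {n m : ℕ} (h : n ≤ m) (y : G m) :
    φ n (downLE t h y) = downLE t' h (φ m y) := by
  induction m, h using Nat.le_induction with
  | base => rw [downLE_refl, downLE_refl]
  | succ m h ih => rw [downLE_succ t h, ih, hφ, ← downLE_succ t' h]

/-- **The ascending transition `G n → G m` (`n ≤ m`)** from one-step maps `s j : G j → G (j+1)`. [cite: NeukirchSchmidtWingberg2008, I §5 Prop. 1.5.2] -/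
def upLE (s : ∀ j : ℕ, G j →+ G (j + 1)) {n m : ℕ} (h : n ≤ m) : G n →+ G m :=
  Nat.leRec (motive := fun m _ ↦ G n →+ G m) (AddMonoidHom.id (G n)) (fun m _ f ↦ (s m).comp f) h

/-- `upLE` along `n ≤ n` is the identity. [folklore] -/
theorem upLE_refl (s : ∀ j : ℕ, G j →+ G (j + 1)) (n : ℕ) (y : G n) : upLE s (le_refl n) y = y := by
  rw [upLE, Nat.leRec_self]; rfl

/-- `upLE` along `n ≤ m + 1` factors through the last step. [folklore] -/
theorem upLE_succ (s : ∀ j : ℕ, G j →+ G (j + 1)) {n m : ℕ} (h : n ≤ m) (h' : n ≤ m + 1) (y : G n) :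
    upLE s h' y = s m (upLE s h y) := by
  rw [upLE, Nat.leRec_succ _ _ h]; rfl

/-- `upLE` along `n ≤ n + 1` is the one-step map. [folklore] -/
theorem upLE_one (s : ∀ j : ℕ, G j →+ G (j + 1)) (n : ℕ) (y : G n) : upLE s (Nat.le_succ n) y = s n y := by
  rw [upLE_succ s (le_refl n), upLE_refl]

/-- `upLE` is transitive. [folklore] -/
theorem upLE_trans (s : ∀ j : ℕ, G j →+ G (j + 1)) {n m l : ℕ} (h : n ≤ m) (h' : m ≤ l) (y : G n) :
    upLE s h' (upLE s h y) = upLE s (h.trans h') y := by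
  induction l, h' using Nat.le_induction generalizing y with
  | base => rw [upLE_refl]
  | succ l h' ih => rw [upLE_succ s h', ih, ← upLE_succ s (h.trans h')]

/-- **Naturality** of `upLE` in maps intertwining the one-step maps. [folklore] -/
theorem upLE_map {G' : ℕ → Type w} [∀ n, AddCommGroup (G' n)] (s : ∀ j : ℕ, G j →+ G (j + 1)) (s' : ∀ j : ℕ, G' j →+ G' (j + 1))
    (φ : ∀ j : ℕ, G j →+ G' j) (hφ : ∀ (j : ℕ) (y : G j), φ (j + 1) (s j y) = s' j (φ j y)) {n m : ℕ} (h : n ≤ m) (y : G n) :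
    φ m (upLE s h y) = upLE s' h (φ n y) := by
  induction m, h using Nat.le_induction generalizing y with
  | base => rw [upLE_refl, upLE_refl]
  | succ m h ih => rw [upLE_succ s h, hφ, ih, ← upLE_succ s' h]

/-- **Adjunction transport**: if `⟨t y, ℓ⟩ = ⟨y, s ℓ⟩` for the one-step maps, then `⟨downLE t h y, ℓ⟩ = ⟨y, upLE s h ℓ⟩` for all `n ≤ m` (projection formula along a tower).
[cite: NeukirchSchmidtWingberg2008, I §5 Prop. 1.5.3 (iv)] -/
theorem pair_downLE_eq_pair_upLE {L : ℕ → Type w} [∀ n, AddCommGroup (L n)] {C : Type*} [AddCommGroup C]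
    (t : ∀ j : ℕ, G (j + 1) →+ G j) (s : ∀ j : ℕ, L j →+ L (j + 1)) (B : ∀ j : ℕ, G j →+ (L j →+ C))
    (hB : ∀ (j : ℕ) (y : G (j + 1)) (ℓ : L j), B j (t j y) ℓ = B (j + 1) y (s j ℓ)) {n m : ℕ} (h : n ≤ m) (y : G m) (ℓ : L n) :
    B n (downLE t h y) ℓ = B m y (upLE s h ℓ) := by
  induction m, h using Nat.le_induction generalizing ℓ with
  | base => rw [downLE_refl, upLE_refl]
  | succ m h ih => rw [downLE_succ t h, ih, hB, ← upLE_succ s h]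

end Generic

/-! ## §2. Double systems: commuting one-step maps give commuting transitions -/

section Double

universe w

variable {G : ℕ → ℕ → Type w} [∀ n k, AddCommGroup (G n k)]
  (c : ∀ n k : ℕ, G (n + 1) k →+ G n k) (r : ∀ n k : ℕ, G n (k + 1) →+ G n k)

/-- **Commutation of all transitions from commutation of the one-step maps**: if `c ∘ r = r ∘ c` on the elementary squares then
`downLE (c · k) ∘ downLE (r n′ ·) = downLE (r n ·) ∘ downLE (c · k′)` for all `n ≤ n′`, `k ≤ k′`. [cite: NeukirchSchmidtWingberg2008, I §5 Prop. 1.5.2] -/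
theorem downLE_comm (hcr : ∀ (n k : ℕ) (y : G (n + 1) (k + 1)), c n k (r (n + 1) k y) = r n k (c n (k + 1) y))
    {n n' : ℕ} (h : n ≤ n') {k k' : ℕ} (h' : k ≤ k') (y : G n' k') :
    downLE (G := fun j ↦ G j k) (fun j ↦ c j k) h (downLE (G := fun j ↦ G n' j) (fun j ↦ r n' j) h' y) =
      downLE (G := fun j ↦ G n j) (fun j ↦ r n j) h' (downLE (G := fun j ↦ G j k') (fun j ↦ c j k') h y) := by
  induction n', h using Nat.le_induction with
  | base => rw [downLE_refl, downLE_refl]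
  | succ n' h ih =>
    rw [downLE_succ _ h, downLE_succ _ h, ← ih]
    congr 1
    exact downLE_map (G := fun j ↦ G (n' + 1) j) (G' := fun j ↦ G n' j) (fun j ↦ r (n' + 1) j) (fun j ↦ r n' j) (fun j ↦ c n' j)
      (fun j z ↦ hcr n' j z) h' y

end Double

/-! ## §3. Honda's layer groups: `cor ∘ red = red ∘ cor`, and the commuting transitions `cycCoresLE`/`cycRedLE` -/

section Layers

variable {K : Type} [Field K] [NumberField K] {p : ℕ} [Fact p.Prime] (S : Set (PadicAlgCl p))
  (κ : ZpExtension K p) (θ : absoluteGaloisGroup K →ₜ* (padicCoeffIntegers S)ˣ) (P : Set (HeightOneSpectrum (𝓞 K))) (i : ℕ)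

/-- ★ **`cor_{K_{n+1}/K_n} ∘ red = red ∘ cor_{K_{n+1}/K_n}`** on `H^i(G_P(K_n), 𝒪 ⊗ μ_{p^k} ⊗ θ)`: the relative corestriction is natural in the coefficient morphism
`id ⊗ (ζ ↦ ζ^p)` (the tree's `relCor_cohomologyMap`, exactly as honda's `cycLayerCoresO_comm` for the coefficient multiplications). [cite: NeukirchSchmidtWingberg2008, I §5 Prop. 1.5.2–1.5.4]
[cite: Kato2004Asterisque, §8.2 (p. 180)] -/
theorem cycLayerCoresO_cycLayerRedO (n k : ℕ) (y : SmallImageRttD2J1.cycLayerCohO S κ θ P (n + 1) (k + 1) i) :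
    SmallImageRttD2J1.cycLayerCoresO S κ θ P n k i (SmallImageRttD2J1.cycLayerRedO S κ θ P (n + 1) k i y) =
      SmallImageRttD2J1.cycLayerRedO S κ θ P n k i (SmallImageRttD2J1.cycLayerCoresO S κ θ P n (k + 1) i y) := by
  haveI : TotallyDisconnectedSpace (GaloisGroupUnramifiedOutside K P) :=
    Literature.GroupTheory.ProfiniteSubquotients.totallyDisconnectedSpace_quotient (ramificationSubgroup K P) (ramificationSubgroup_isClosed K _)
  haveI := normal_imGS P (κ.layerSubgroup n)
  haveI := normal_imGS P (κ.layerSubgroup (n + 1))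
  haveI : IsClosed (imGS P (κ.layerSubgroup n) : Set (GaloisGroupUnramifiedOutside K P)) := isClosed_imGS' _ (κ.isOpen_layerSubgroup n)
  haveI : IsClosed (imGS P (κ.layerSubgroup (n + 1)) : Set (GaloisGroupUnramifiedOutside K P)) := isClosed_imGS' _ (κ.isOpen_layerSubgroup (n + 1))
  haveI : ((imGS P (κ.layerSubgroup (n + 1))).subgroupOf (imGS P (κ.layerSubgroup n))).FiniteIndex := by
    haveI := finiteIndex_imGS' P (κ.isOpen_layerSubgroup (n + 1))
    infer_instance
  letI : Fintype (↥(imGS P (κ.layerSubgroup n)) ⧸ (imGS P (κ.layerSubgroup (n + 1))).subgroupOf (imGS P (κ.layerSubgroup n))) := Fintype.ofFinite _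
  exact relCor_cohomologyMap (imGS P (κ.layerSubgroup n)) (imGS P (κ.layerSubgroup (n + 1))) (coeffGSO S P θ (k + 1)) (coeffGSO S P θ k)
    (coeffMapHomO S P θ (oMuRed S k) (oMuRed_muTwistO S θ k)) (Subgroup.map_mono (κ.layerSubgroup_antitone (Nat.le_succ n))) i y

/-- **`cycCoresLE h k : H^i(G_P(K_{n′}), ·)_k → H^i(G_P(K_n), ·)_k`** (`n ≤ n′`), the iterated corestriction (`downLE` of honda's `cycLayerCoresO`).
[cite: NeukirchSchmidtWingberg2008, I §5 Prop. 1.5.2] -/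
def cycCoresLE {n n' : ℕ} (h : n ≤ n') (k : ℕ) : SmallImageRttD2J1.cycLayerCohO S κ θ P n' k i →+ SmallImageRttD2J1.cycLayerCohO S κ θ P n k i :=
  downLE (G := fun j ↦ SmallImageRttD2J1.cycLayerCohO S κ θ P j k i) (fun j ↦ SmallImageRttD2J1.cycLayerCoresO S κ θ P j k i) h

/-- **`cycRedLE n h : H^i(·)_{k′} → H^i(·)_k`** (`k ≤ k′`), the iterated reduction (`downLE` of honda's `cycLayerRedO`). [cite: Kato2004Asterisque, §8.2 (p. 180)] -/
def cycRedLE (n : ℕ) {k k' : ℕ} (h : k ≤ k') : SmallImageRttD2J1.cycLayerCohO S κ θ P n k' i →+ SmallImageRttD2J1.cycLayerCohO S κ θ P n k i :=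
  downLE (G := fun j ↦ SmallImageRttD2J1.cycLayerCohO S κ θ P n j i) (fun j ↦ SmallImageRttD2J1.cycLayerRedO S κ θ P n j i) h

/-- `cycCoresLE` along `n ≤ n` is the identity. [folklore] -/
theorem cycCoresLE_refl (n k : ℕ) (y : SmallImageRttD2J1.cycLayerCohO S κ θ P n k i) : cycCoresLE S κ θ P i (le_refl n) k y = y :=
  downLE_refl (G := fun j ↦ SmallImageRttD2J1.cycLayerCohO S κ θ P j k i) _ n y

/-- `cycCoresLE` is transitive. [folklore] -/
theorem cycCoresLE_trans {n n' n'' : ℕ} (h : n ≤ n') (h' : n' ≤ n'') (k : ℕ) (y : SmallImageRttD2J1.cycLayerCohO S κ θ P n'' k i) :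
    cycCoresLE S κ θ P i h k (cycCoresLE S κ θ P i h' k y) = cycCoresLE S κ θ P i (h.trans h') k y :=
  downLE_trans (G := fun j ↦ SmallImageRttD2J1.cycLayerCohO S κ θ P j k i) _ h h' y

/-- `cycCoresLE` along `n ≤ n + 1` is `cycLayerCoresO`. [folklore] -/
theorem cycCoresLE_succ (n k : ℕ) (y : SmallImageRttD2J1.cycLayerCohO S κ θ P (n + 1) k i) :
    cycCoresLE S κ θ P i (Nat.le_succ n) k y = SmallImageRttD2J1.cycLayerCoresO S κ θ P n k i y :=
  downLE_one (G := fun j ↦ SmallImageRttD2J1.cycLayerCohO S κ θ P j k i) _ n y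

omit [NumberField K] in
/-- `cycRedLE` along `k ≤ k` is the identity. [folklore] -/
theorem cycRedLE_refl (n k : ℕ) (y : SmallImageRttD2J1.cycLayerCohO S κ θ P n k i) : cycRedLE S κ θ P i n (le_refl k) y = y :=
  downLE_refl (G := fun j ↦ SmallImageRttD2J1.cycLayerCohO S κ θ P n j i) _ k y

omit [NumberField K] in
/-- `cycRedLE` is transitive. [folklore] -/
theorem cycRedLE_trans (n : ℕ) {k k' k'' : ℕ} (h : k ≤ k') (h' : k' ≤ k'') (y : SmallImageRttD2J1.cycLayerCohO S κ θ P n k'' i) :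
    cycRedLE S κ θ P i n h (cycRedLE S κ θ P i n h' y) = cycRedLE S κ θ P i n (h.trans h') y :=
  downLE_trans (G := fun j ↦ SmallImageRttD2J1.cycLayerCohO S κ θ P n j i) _ h h' y

omit [NumberField K] in
/-- `cycRedLE` along `k ≤ k + 1` is `cycLayerRedO`. [folklore] -/
theorem cycRedLE_succ (n k : ℕ) (y : SmallImageRttD2J1.cycLayerCohO S κ θ P n (k + 1) i) :
    cycRedLE S κ θ P i n (Nat.le_succ k) y = SmallImageRttD2J1.cycLayerRedO S κ θ P n k i y :=
  downLE_one (G := fun j ↦ SmallImageRttD2J1.cycLayerCohO S κ θ P n j i) _ k y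

/-- ★ **All corestrictions commute with all reductions** on honda's layer groups. [cite: NeukirchSchmidtWingberg2008, I §5 Prop. 1.5.2–1.5.4] [cite: Kato2004Asterisque, §8.2 (p. 180)] -/
theorem cycCoresLE_cycRedLE {n n' : ℕ} (h : n ≤ n') {k k' : ℕ} (h' : k ≤ k') (y : SmallImageRttD2J1.cycLayerCohO S κ θ P n' k' i) :
    cycCoresLE S κ θ P i h k (cycRedLE S κ θ P i n' h' y) = cycRedLE S κ θ P i n h' (cycCoresLE S κ θ P i h k' y) :=
  downLE_comm (G := fun a b ↦ SmallImageRttD2J1.cycLayerCohO S κ θ P a b i) (fun a b ↦ SmallImageRttD2J1.cycLayerCoresO S κ θ P a b i)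
    (fun a b ↦ SmallImageRttD2J1.cycLayerRedO S κ θ P a b i) (fun a b z ↦ cycLayerCoresO_cycLayerRedO S κ θ P i a b z) h h' y

/-- The projections of honda's datum are `cycCoresLE`-compatible (pin (P1), iterated). [cite: Kato2004Asterisque, §8.2 (p. 180)] -/
theorem proj_eq_cycCoresLE {γ : absoluteGaloisGroup K} (I : SmallImageRttD2J1.CycIwasawaCohomologyDataO S κ γ θ P i) (x : I.H) {n n' : ℕ} (h : n ≤ n') (k : ℕ) :
    I.proj n k x = cycCoresLE S κ θ P i h k (I.proj n' k x) := by
  induction n', h using Nat.le_induction with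
  | base => rw [cycCoresLE_refl]
  | succ n' h ih => rw [← cycCoresLE_trans S κ θ P i h (Nat.le_succ n'), cycCoresLE_succ, I.proj_cores, ih]

/-- The projections of honda's datum are `cycRedLE`-compatible (pin (P2), iterated). [cite: Kato2004Asterisque, §8.2 (p. 180)] -/
theorem proj_eq_cycRedLE {γ : absoluteGaloisGroup K} (I : SmallImageRttD2J1.CycIwasawaCohomologyDataO S κ γ θ P i) (x : I.H) (n : ℕ) {k k' : ℕ} (h : k ≤ k') :
    I.proj n k x = cycRedLE S κ θ P i n h (I.proj n k' x) := by
  induction k', h using Nat.le_induction with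
  | base => rw [cycRedLE_refl]
  | succ k' h ih => rw [← cycRedLE_trans S κ θ P i n h (Nat.le_succ k'), cycRedLE_succ, I.proj_red, ih]

end Layers

end Summit.BirchSwinnertonDyer.BirchSwinnertonDyer.Theorems.SmallImageRttD2Seq

end
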